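import Mathlib.RepresentationTheory.Irreducible
import Mathlib.RepresentationTheory.Semisimple
import Mathlib.RingTheory.SimpleModule.Basic
import Mathlib.Algebra.DirectSum.Module
import Mathlib.LinearAlgebra.TensorProduct.Basis
import Mathlib.LinearAlgebra.DirectSum.Finsupp
import HarnessLib

/-!
# A semisimple representation is, equivariantly, a direct sum of irreducible representations
# (no finiteness hypothesis)

Topic `Literature/RepresentationTheory/Semisimple`; theorems only (no definition, no named fact).

Let `k` be a field, `G` a group and `H` a `k`-vector space carrying a compatible `k[G]`-module structure
(`Module (MonoidAlgebra k G) H`, `IsScalarTower k (MonoidAlgebra k G) H`) — equivalently a `k`-linear representation of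
`G` on `H`, `g ↦ (MonoidAlgebra.of k G g • ·) = Representation.ofModule' H g`.  If `H` is a SEMISIMPLE `k[G]`-module
(every submodule has a complement; Mathlib `IsSemisimpleModule`, for representations `Representation.IsSemisimpleRepresentation`)
then there are an index type `ι`, `k`-vector spaces `W i` with IRREDUCIBLE representations `σ i : G → GL(W i)`
(Mathlib `Representation.IsIrreducible`: non-zero, no proper non-zero subrepresentation) and a `k`-LINEAR isomorphism
`Ψ : H ≃ ⨁ i, W i` which is `G`-equivariant coordinatewise, `Ψ (g • x) i = σ i g (Ψ x i)`:

* `exists_equivariant_directSum_of_isSemisimpleModule` — module form (`g • x = MonoidAlgebra.of k G g • x`);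
* `exists_equivariant_directSum_of_ofModule'` — the same written with `Representation.ofModule' H`;
* `Representation.exists_equivariant_directSum_of_isSemisimpleRepresentation` — for a representation `τ : G → GL(H)` with
  `τ.IsSemisimpleRepresentation`, `Ψ (τ g x) i = σ i g (Ψ x i)`.

There is NO finite-dimensionality or finiteness-of-`G` hypothesis: this is the module-theoretic fact that a semisimple module is a
direct sum of simple submodules (Mathlib `IsSemisimpleModule.exists_linearEquiv_dfinsupp`), read back in the language of
representations (`W i :=` the simple submodules, `σ i := Representation.ofModule'`, irreducibility by Mathlib's
`Representation.irreducible_iff_isSimpleModule_asModule`).  Also recorded: the elementary converse direction used to FEED the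
hypothesis from a «Matsushima-shaped» decomposition — a `k[G]`-module `k[G]`-isomorphic to a direct sum `⨁ p, (F p ⊗[k] M p)` of
simple modules `F p` tensored with plain `k`-vector spaces `M p` (multiplicity spaces) is semisimple
(`isSemisimpleModule_tensorProduct_of_isSimpleModule`, `isSemisimpleModule_of_linearEquiv_directSum_tensor`).

Consumer: the Hodge–CM formalisation (cell `hodgecm-mathlib`, fan A, binder `h413` = [Liu 2021, Prop. 4.13]): the analytic half of
Liu's proof («`H¹_{B,τ'}(A_∞, ℂ)` is a direct sum of irreducible `𝔾(𝔸_F^∞)`-representations») is exactly this statement applied to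
the semisimplicity delivered by Matsushima's formula [Liu 2021, App. D, (D.1)].

## References
* [Lang2002] S. Lang, *Algebra*, rev. 3rd ed., GTM 211 — XVII §2 «Conditions defining semisimplicity» (SS 1 sum of simple
  submodules ⇔ SS 2 direct sum of simple submodules ⇔ SS 3 every submodule is a direct summand; held text `book:langnd-algebra`
  chunk p0358) — the module-theoretic content; XVIII §1 (a representation `G → Aut_k(E)` is the same as a `k[G]`-module structure
  on `E`, `G`-homomorphisms = `k[G]`-linear maps; chunk p0368) — the dictionary.
* [Liu2021] Y. Liu, Camb. J. Math. 9 (2021) — Prop. 4.13, proof l. 2121–2131; App. D (D.1) (the consumer).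
-/

noncomputable section

open scoped DirectSum TensorProduct

namespace Literature.RepresentationTheory.Semisimple

universe uk uG uH uP uF uM

section Module

variable {k : Type uk} [Field k] {G : Type uG} [Group G]

/-- `Representation.ofModule' M` acts by the group-algebra generators: `ofModule' M g m = of g • m` (the dictionary
«representation of `G` ↔ `k[G]`-module», Lang XVIII §1). [cite: Lang2002, XVIII §1] -/
theorem ofModule'_apply_eq_of_smul (M : Type uH) [AddCommGroup M] [Module k M] [Module (MonoidAlgebra k G) M]
    [IsScalarTower k (MonoidAlgebra k G) M] (g : G) (m : M) :
    Representation.ofModule' (k := k) (G := G) M g m = MonoidAlgebra.of k G g • m := by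
  rw [Representation.ofModule', MonoidAlgebra.lift_symm_apply, MonoidAlgebra.of_apply, Algebra.lsmul_coe]

/-- The `k[G]`-algebra map of `Representation.ofModule' M` is the scalar action of `k[G]` on `M` itself (Lang XVIII §1: the
extension of `ρ` to `k[G]`). [cite: Lang2002, XVIII §1] -/
theorem asAlgebraHom_ofModule' (M : Type uH) [AddCommGroup M] [Module k M] [Module (MonoidAlgebra k G) M]
    [IsScalarTower k (MonoidAlgebra k G) M] (r : MonoidAlgebra k G) (m : M) :
    (Representation.ofModule' (k := k) (G := G) M).asAlgebraHom r m = r • m := by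
  rw [Representation.asAlgebraHom_def, Representation.ofModule', Equiv.apply_symm_apply, Algebra.lsmul_coe]

/-- For `Representation.ofModule' M` the module `(ofModule' M).asModule` IS `M` as a `k[G]`-module: the identity map is a
`k[G]`-linear isomorphism (stated as an existence so that this file declares theorems only; Lang XVIII §1 dictionary).
[cite: Lang2002, XVIII §1] -/
theorem nonempty_asModule_linearEquiv_ofModule' (M : Type uH) [AddCommGroup M] [Module k M]
    [Module (MonoidAlgebra k G) M] [IsScalarTower k (MonoidAlgebra k G) M] :
    Nonempty ((Representation.ofModule' (k := k) (G := G) M).asModule ≃ₗ[MonoidAlgebra k G] M) :=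
  ⟨{ (Representation.ofModule' (k := k) (G := G) M).asModuleEquiv with
      map_smul' := fun r x => by
        change (Representation.ofModule' (k := k) (G := G) M).asModuleEquiv (r • x) = r • _
        rw [Representation.asModuleEquiv_map_smul, asAlgebraHom_ofModule']
        rfl }⟩

/-- A SIMPLE `k[G]`-module `M` (with its compatible `k`-structure) gives an IRREDUCIBLE representation `ofModule' M`
(Mathlib's `irreducible_iff_isSimpleModule_asModule`, the `asModule` of `ofModule' M` being `M` itself; Lang XVIII §1: simple
`k[G]`-module = irreducible representation). [cite: Lang2002, XVIII §1] -/
theorem isIrreducible_ofModule' (M : Type uH) [AddCommGroup M] [Module k M] [Module (MonoidAlgebra k G) M]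
    [IsScalarTower k (MonoidAlgebra k G) M] [IsSimpleModule (MonoidAlgebra k G) M] :
    (Representation.ofModule' (k := k) (G := G) M).IsIrreducible := by
  obtain ⟨e⟩ := nonempty_asModule_linearEquiv_ofModule' (k := k) (G := G) M
  exact (Representation.irreducible_iff_isSimpleModule_asModule _).mpr (IsSimpleModule.congr e)

/-- `ofModule' M` is a semisimple representation iff `M` is a semisimple `k[G]`-module (Lang XVII §2 SS 3 read through the
XVIII §1 dictionary). [cite: Lang2002, XVII §2 (SS 3); XVIII §1] -/
theorem isSemisimpleRepresentation_ofModule'_iff (M : Type uH) [AddCommGroup M] [Module k M]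
    [Module (MonoidAlgebra k G) M] [IsScalarTower k (MonoidAlgebra k G) M] :
    (Representation.ofModule' (k := k) (G := G) M).IsSemisimpleRepresentation ↔
      IsSemisimpleModule (MonoidAlgebra k G) M := by
  obtain ⟨e⟩ := nonempty_asModule_linearEquiv_ofModule' (k := k) (G := G) M
  rw [Representation.isSemisimpleRepresentation_iff_isSemisimpleModule_asModule]
  exact e.isSemisimpleModule_iff

variable {H : Type uH} [AddCommGroup H] [Module k H] [Module (MonoidAlgebra k G) H]
  [IsScalarTower k (MonoidAlgebra k G) H]

/-- **A semisimple `k[G]`-module is, `G`-equivariantly and `k`-linearly, a direct sum of irreducible representations.**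
If `H` is a semisimple `k[G]`-module then there are `ι`, `k`-spaces `W i`, IRREDUCIBLE representations `σ i` of `G` on `W i`
and a `k`-linear isomorphism `Ψ : H ≃ ⨁ i, W i` with `Ψ (of g • x) i = σ i g (Ψ x i)`.  (`ι` = a set of simple submodules with
independent sum `⊤`, `W i` = the submodule, `σ i = ofModule'`.) No finiteness hypothesis.  This is Lang XVII §2, SS 3 ⇒ SS 2
(«E is the direct sum of a family of simple submodules»), in the language of representations (XVIII §1).
[cite: Lang2002, XVII §2 (SS 3 ⇒ SS 2); XVIII §1] -/
theorem exists_equivariant_directSum_of_isSemisimpleModule [IsSemisimpleModule (MonoidAlgebra k G) H] :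
    ∃ (ι : Type uH) (W : ι → Type uH) (_ : ∀ i, AddCommGroup (W i)) (_ : ∀ i, Module k (W i))
      (σ : ∀ i, Representation k G (W i)), (∀ i, (σ i).IsIrreducible) ∧
      ∃ Ψ : H ≃ₗ[k] (⨁ i, W i), ∀ (g : G) (x : H) (i : ι), Ψ (MonoidAlgebra.of k G g • x) i = σ i g (Ψ x i) := by
  obtain ⟨s, e, -, hs⟩ := IsSemisimpleModule.exists_linearEquiv_dfinsupp (MonoidAlgebra k G) H
  haveI : ∀ m : s, IsSimpleModule (MonoidAlgebra k G) (m.1 : Submodule (MonoidAlgebra k G) H) := hs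
  refine ⟨s, fun m => (m.1 : Submodule (MonoidAlgebra k G) H), fun m => inferInstance, fun m => inferInstance,
    fun m => Representation.ofModule' (k := k) (G := G) (m.1 : Submodule (MonoidAlgebra k G) H),
    fun m => isIrreducible_ofModule' _, e.restrictScalars k, fun g x m => ?_⟩
  change e (MonoidAlgebra.of k G g • x) m =
    Representation.ofModule' (k := k) (G := G) (m.1 : Submodule (MonoidAlgebra k G) H) g (e x m)
  rw [map_smul, ofModule'_apply_eq_of_smul, DFinsupp.smul_apply]

/-- The same, written with `Representation.ofModule' H` (the representation `g ↦ (of g • ·)` of the module).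
[cite: Lang2002, XVII §2 (SS 3 ⇒ SS 2); XVIII §1] -/
theorem exists_equivariant_directSum_of_ofModule' [IsSemisimpleModule (MonoidAlgebra k G) H] :
    ∃ (ι : Type uH) (W : ι → Type uH) (_ : ∀ i, AddCommGroup (W i)) (_ : ∀ i, Module k (W i))
      (σ : ∀ i, Representation k G (W i)), (∀ i, (σ i).IsIrreducible) ∧
      ∃ Ψ : H ≃ₗ[k] (⨁ i, W i), ∀ (g : G) (x : H) (i : ι),
        Ψ (Representation.ofModule' (k := k) (G := G) H g x) i = σ i g (Ψ x i) := by
  obtain ⟨ι, W, iA, iM, σ, hσ, Ψ, hΨ⟩ := exists_equivariant_directSum_of_isSemisimpleModule (k := k) (G := G) (H := H)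
  exact ⟨ι, W, iA, iM, σ, hσ, Ψ, fun g x i => by rw [ofModule'_apply_eq_of_smul, hΨ]⟩

/-- The same under the hypothesis `(ofModule' H).IsSemisimpleRepresentation` (Mathlib's lattice-of-subrepresentations form of
SS 3). [cite: Lang2002, XVII §2 (SS 3 ⇒ SS 2); XVIII §1] -/
theorem exists_equivariant_directSum_of_isSemisimpleRepresentation_ofModule'
    (h : (Representation.ofModule' (k := k) (G := G) H).IsSemisimpleRepresentation) :
    ∃ (ι : Type uH) (W : ι → Type uH) (_ : ∀ i, AddCommGroup (W i)) (_ : ∀ i, Module k (W i))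
      (σ : ∀ i, Representation k G (W i)), (∀ i, (σ i).IsIrreducible) ∧
      ∃ Ψ : H ≃ₗ[k] (⨁ i, W i), ∀ (g : G) (x : H) (i : ι),
        Ψ (Representation.ofModule' (k := k) (G := G) H g x) i = σ i g (Ψ x i) := by
  haveI := (isSemisimpleRepresentation_ofModule'_iff H).mp h
  exact exists_equivariant_directSum_of_ofModule'

end Module

section Representation

variable {k : Type uk} [Field k] {G : Type uG} [Group G]
variable {H : Type uH} [AddCommGroup H] [Module k H]

/-- **A semisimple representation is, equivariantly, a direct sum of irreducible representations** (representation form):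
for `τ : G → GL(H)` with `τ.IsSemisimpleRepresentation` there are irreducible `σ i : G → GL(W i)` and a `k`-linear
`Ψ : H ≃ ⨁ i, W i` with `Ψ (τ g x) i = σ i g (Ψ x i)`.  No finiteness hypothesis (Lang XVII §2, SS 3 ⇒ SS 2, for the
`k[G]`-module of `τ`).  Declared in Mathlib's `Representation` namespace deliberately (dot notation on `τ`).
[cite: Lang2002, XVII §2 (SS 3 ⇒ SS 2); XVIII §1] -/
theorem _root_.Representation.exists_equivariant_directSum_of_isSemisimpleRepresentation (τ : Representation k G H)
    (h : τ.IsSemisimpleRepresentation) :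
    ∃ (ι : Type uH) (W : ι → Type uH) (_ : ∀ i, AddCommGroup (W i)) (_ : ∀ i, Module k (W i))
      (σ : ∀ i, Representation k G (W i)), (∀ i, (σ i).IsIrreducible) ∧
      ∃ Ψ : H ≃ₗ[k] (⨁ i, W i), ∀ (g : G) (x : H) (i : ι), Ψ (τ g x) i = σ i g (Ψ x i) := by
  haveI : IsSemisimpleModule (MonoidAlgebra k G) τ.asModule :=
    (Representation.isSemisimpleRepresentation_iff_isSemisimpleModule_asModule τ).mp h
  obtain ⟨ι, W, iA, iM, σ, hσ, Ψ, hΨ⟩ :=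
    exists_equivariant_directSum_of_isSemisimpleModule (k := k) (G := G) (H := τ.asModule)
  refine ⟨ι, W, iA, iM, σ, hσ, τ.asModuleEquiv.symm.trans Ψ, fun g x i => ?_⟩
  rw [LinearEquiv.trans_apply, LinearEquiv.trans_apply, Representation.asModuleEquiv_symm_map_rho, hΨ]

end Representation

/-! ## Feeding the hypothesis: Matsushima-shaped decompositions are semisimple -/

section Tensor

variable {k : Type uk} [Field k] {A : Type uG} [Ring A] [Algebra k A]

/-- A simple `A`-module tensored (over the ground field `k`) with a plain `k`-vector space `M` — `A` acting on the left
factor — is a semisimple `A`-module: choosing a basis `b` of `M`, `F ⊗ M ≅ ⨁_{b} F` `A`-linearly, a direct sum of simple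
modules (Lang XVII §2, SS 2 ⇒ SS 3). [cite: Lang2002, XVII §2 (SS 2 ⇒ SS 3)] -/
theorem isSemisimpleModule_tensorProduct_of_isSimpleModule (F : Type uF) [AddCommGroup F] [Module k F] [Module A F]
    [IsScalarTower k A F] (M : Type uM) [AddCommGroup M] [Module k M] [IsSimpleModule A F] :
    IsSemisimpleModule A (F ⊗[k] M) := by
  classical
  let b := Module.Free.chooseBasis k M
  -- `F ⊗ M ≃ₗ[A] (ι →₀ F)` through the basis `b`
  let e : F ⊗[k] M ≃ₗ[A] (Module.Free.ChooseBasisIndex k M →₀ F) :=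
    (TensorProduct.AlgebraTensorModule.congr (LinearEquiv.refl A F) b.repr).trans
      (TensorProduct.finsuppScalarRight k A F (Module.Free.ChooseBasisIndex k M))
  exact IsSemisimpleModule.congr e

/-- **A `k[G]`-module (more generally an `A`-module, `A` a `k`-algebra) which is `A`-isomorphic to a direct sum
`⨁ p, (F p ⊗[k] M p)` of SIMPLE modules `F p` tensored with `k`-vector spaces `M p` is semisimple** — the shape of
Matsushima's formula `H ≅ ⊕_π π^∞ ⊗ (m(π)·H^q(𝔤,K;π_∞))` [Liu2021, App. D (D.1)] (Lang XVII §2, SS 2 ⇒ SS 3).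
[cite: Lang2002, XVII §2 (SS 2 ⇒ SS 3)] -/
theorem isSemisimpleModule_of_linearEquiv_directSum_tensor {H : Type uH} [AddCommGroup H] [Module A H]
    {P : Type uP} (F : P → Type uF) [∀ p, AddCommGroup (F p)] [∀ p, Module k (F p)] [∀ p, Module A (F p)]
    [∀ p, IsScalarTower k A (F p)] [∀ p, IsSimpleModule A (F p)]
    (M : P → Type uM) [∀ p, AddCommGroup (M p)] [∀ p, Module k (M p)]
    (e : H ≃ₗ[A] (⨁ p, (F p ⊗[k] M p))) : IsSemisimpleModule A H := by
  haveI : ∀ p, IsSemisimpleModule A (F p ⊗[k] M p) := fun p =>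
    isSemisimpleModule_tensorProduct_of_isSimpleModule (k := k) (A := A) (F p) (M p)
  haveI : IsSemisimpleModule A (⨁ p, (F p ⊗[k] M p)) :=
    inferInstanceAs (IsSemisimpleModule A (Π₀ p, (F p ⊗[k] M p)))
  exact IsSemisimpleModule.congr e

end Tensor

end Literature.RepresentationTheory.Semisimple

end
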